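import Summits.CriticalPhenomena.PercolationContinuityZ3.Theorems.Transplant.KNCellsScheme
import HarnessLib

/-!
# F8 (generic), regression — Kozma–Nitzan's own cells of `ℤ^d` as an anchored cell geometry with trivial anchors
# (BLUEPRINT-I-PHI §3 Φ11 / Φ-inst-ℤ^d; the `A = Unit` instance of `Transplant/KNCellsScheme.lean`)

builds on p205010 (kernel theorem, internal audit signed; external expert review pending) — nothing in this file uses p205010.
Lane `prim-bschramm`, seat `prim-bschramm-p2` (task F8); helper file (`--supports stmt-CriticalPhenomena-4575`).

The anchored scheme of `KNCellsScheme` / `KNCellsProcess` specialises to Kozma–Nitzan's original `KSch d` (`L/KozmaNitzanScheme.lean`) when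
the anchor type is `Unit`: this file records that instance — `CellGeom.ofCells C` (KN's `Cells d`: `Q`, `M`, `Cell`, `Btw`, `Efar`, `Stub`,
`Zone`, root `0`, planar column `col x = {cen x}` so that the column test IS the original marker test `cen x ∈ E_i`, constant anchor rule) and
`KSchA.ofKSch S` — together with the definitional identities with the original (`U₀`, `F`, explored region, pattern, `Ewv`, `Sx`, `Fj`,
`Conn`, `onward`), which are the regression test of the generalisation: the `ℤ^d` process is an instance, not a fork.

[cite: KozmaNitzan2024, §4 pp. 25–27 — the ℤ^d model]
-/

noncomputable section

open MeasureTheory ProbabilityTheory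
open scoped ENNReal Classical

namespace Summit.CriticalPhenomena.PercolationContinuityZ3.Theorems

namespace Transplant

namespace KNCells

open Literature.Probability.Percolation Literature.Probability.LatticeModels SimpleGraph GadgetSystem ProbeHistory
open Literature.Probability.Percolation.KozmaNitzan

variable {d : ℕ}

/-- **Kozma–Nitzan's cells as an anchored cell geometry with trivial anchors** (`A = Unit`): the boxes of `Cells d`, root `0`, planar column
`{cen x}` (so that `onward` is KN's (29) marker test verbatim), constant re-centring rule. [cite: KozmaNitzan2024, §4 pp. 25–26] -/
def CellGeom.ofCells (C : Cells d) : CellGeom (Site d) Unit where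
  K := C.K
  root := 0
  a₀ := ()
  Q := fun _ v => C.Q v
  M := fun _ v => C.M v
  Cell := fun _ v => C.Cell v
  Btw := fun _ v δ => C.Btw v δ
  Efar := fun _ v δ => C.Efar v δ
  Stub := fun _ v δ j => C.Stub v δ j
  Zone := fun _ v δ => C.Zone v δ
  col := fun x => {C.cen x}
  anchor := fun _ _ _ => ()
  anchSet := fun _ _ => {()}
  anchor_mem := fun _ _ _ => Finset.mem_singleton_self _
  stub_mono := fun _ v δ _ _ h => C.stub_mono v δ h
  hK := by have := C.hK; omega

/-- **Kozma–Nitzan's scheme parameters as anchored scheme parameters.** [cite: KozmaNitzan2024, §4 pp. 25–27] -/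
def KSchA.ofKSch (S : KSch d) : KSchA (Site d) Unit := ⟨CellGeom.ofCells S.C, S.p, S.δc⟩

namespace KSchA

variable (S : KSch d)

/-- The generic span is KN's span on `ℤ^d`. [folklore] -/
theorem vspan_eq_span (F : Finset (Sym2 (Site d))) : vspan F = span F := rfl

/-- `E_{v,x}` of the instance is KN's `Ewv`. [folklore] -/
@[simp] theorem ofKSch_Ewv (a : Unit) (v : Site 2) (δ : MDir) : (ofKSch S).Γ.Ewv a v δ = S.C.Ewv v δ := rfl

/-- The initial edges of the instance are KN's `U₀`. [folklore] -/
@[simp] theorem ofKSch_U₀ : (ofKSch S).U₀ (zdGraph d) = S.U₀ := rfl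

/-- The explored edges of the instance are KN's `F`. [folklore] -/
@[simp] theorem ofKSch_F (h : ProbeHistory (Site d)) : (ofKSch S).F (zdGraph d) h = S.F h := rfl

/-- The explored region of the instance is KN's `E_i`. [folklore] -/
@[simp] theorem ofKSch_Vx (h : ProbeHistory (Site d)) : (ofKSch S).Vx (zdGraph d) h = S.V h := rfl

/-- The recorded pattern of the instance is KN's `ξ`. [folklore] -/
@[simp] theorem ofKSch_ξ (h : ProbeHistory (Site d)) : (ofKSch S).ξ (zdGraph d) h = S.ξ h := rfl

/-- **The planar column test of the instance is KN's marker test (29)**: the onward directions agree. [cite: KozmaNitzan2024, §4 p. 26 (29)] -/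
@[simp] theorem ofKSch_onward (h : ProbeHistory (Site d)) (v : Site 2) : (ofKSch S).onward (zdGraph d) h v = S.onward h v := by
  unfold KSchA.onward KSch.onward
  refine Finset.filter_congr fun du _ => ?_
  simp only [ofKSch, CellGeom.ofCells, Set.mem_singleton_iff]
  exact ⟨fun h' hmem => h' _ hmem rfl, fun h' y hy hyc => h' (hyc ▸ hy)⟩

/-- The support of the examination of the instance is KN's `Sx`. [folklore] -/
@[simp] theorem ofKSch_Sx (h : ProbeHistory (Site d)) (e : Site 2 × MDir) (a a' : Unit) (du : MDir) :
    (ofKSch S).Sx (zdGraph d) h e a a' du = S.Sx h e du := rfl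

/-- The conditioned edges of the instance are KN's `Fj`. [folklore] -/
@[simp] theorem ofKSch_Fj (h : ProbeHistory (Site d)) (e : Site 2 × MDir) (a a' : Unit) (du : MDir) (j : ℕ) :
    (ofKSch S).Fj (zdGraph d) h e a a' du j = S.Fj h e du j := rfl

/-- The target event of the instance is KN's `Conn`. [folklore] -/
@[simp] theorem ofKSch_Conn (a' : Unit) (e : Site 2 × MDir) (du : MDir) : (ofKSch S).Conn a' e du = S.Conn e du := rfl

/-- The pinned pattern of the instance is KN's `pat`. [folklore] -/
@[simp] theorem ofKSch_pat (h : ProbeHistory (Site d)) (e : Site 2 × MDir) (a a' : Unit) (du : MDir) (j : ℕ) (o : Finset (Sym2 (Site d))) :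
    (ofKSch S).pat (zdGraph d) h e a a' du j o = S.pat h e du j o := rfl

/-- The weighting (30) of the instance is KN's `Wt` (with the generic graph weighting `KNLevels.lattW (zdGraph d) p = KozmaNitzan.lattW d p`).
[cite: KozmaNitzan2024, §4 p. 27 ((30))] -/
theorem ofKSch_Wt (h : ProbeHistory (Site d)) (e : Site 2 × MDir) (a a' : Unit) (du : MDir) (j : ℕ) (o : Finset (Sym2 (Site d))) :
    (ofKSch S).Wt (zdGraph d) h e a a' du j o = S.Wt h e du j o := by
  unfold KSchA.Wt KSch.Wt
  rw [ofKSch_Sx, ofKSch_Fj, ofKSch_pat]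
  congr 2
  funext x
  rw [KNLevels.lattW_apply, KozmaNitzan.lattW_apply]
  rfl

/-- (30) of the instance is KN's (30). [cite: KozmaNitzan2024, §4 p. 27 ((30))] -/
@[simp] theorem ofKSch_cond (h : ProbeHistory (Site d)) (e : Site 2 × MDir) (a a' : Unit) (du : MDir) (j : ℕ) (o : Finset (Sym2 (Site d))) :
    (ofKSch S).cond (zdGraph d) h e a a' du j o ↔ S.cond h e du j o := by
  unfold KSchA.cond KSch.cond
  rw [ofKSch_Wt, ofKSch_Conn]; rfl

/-- `j_x` of the instance is KN's `j_x`. [cite: KozmaNitzan2024, §4 p. 27 (j_x)] -/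
@[simp] theorem ofKSch_jOf (h : ProbeHistory (Site d)) (e : Site 2 × MDir) (a a' : Unit) (du : MDir) (o : Finset (Sym2 (Site d))) :
    (ofKSch S).jOf (zdGraph d) h e a a' du o = S.jOf h e du o := by
  unfold KSchA.jOf KSch.jOf
  congr 1
  funext j
  exact propext (ofKSch_cond S h e a a' du j o)

/-- The new region of the instance is KN's `newRegion`. [cite: KozmaNitzan2024, §4 p. 27 (E_{i+1})] -/
@[simp] theorem ofKSch_newRegion (h : ProbeHistory (Site d)) (e : Site 2 × MDir) (a a' : Unit) (o : Finset (Sym2 (Site d))) :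
    (ofKSch S).newRegion (zdGraph d) h e a a' o = S.newRegion h e o := by
  unfold KSchA.newRegion KSch.newRegion
  rw [ofKSch_Ewv, ofKSch_onward]
  refine congrArg (S.C.Ewv e.1 e.2 ∪ ·) ?_
  exact Finset.biUnion_congr rfl fun du _ => by rw [ofKSch_jOf]; rfl

/-- The revealed edges of the instance are KN's `revealOf`. [cite: KozmaNitzan2024, §4 p. 27 (E_{i+1})] -/
@[simp] theorem ofKSch_revealOf (h : ProbeHistory (Site d)) (e : Site 2 × MDir) (a : Unit) (o : Finset (Sym2 (Site d))) :
    (ofKSch S).revealOf (zdGraph d) h e a o = S.revealOf h e o := by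
  unfold KSchA.revealOf KSch.revealOf
  rw [ofKSch_newRegion, ofKSch_Vx, ofKSch_F]

/-- **Success of the instance is KN's success.** [cite: KozmaNitzan2024, §4 p. 27] -/
@[simp] theorem ofKSch_succA (h : ProbeHistory (Site d)) (e : Site 2 × MDir) (a : Unit) (o : Finset (Sym2 (Site d))) :
    (ofKSch S).succA (zdGraph d) h e a o ↔ S.succ h e o := by
  unfold KSchA.succA KSch.succ
  rw [ofKSch_onward]
  refine forall₂_congr fun du _ => ?_
  rw [ofKSch_jOf, ofKSch_cond]

end KSchA

end KNCells

end Transplant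

end Summit.CriticalPhenomena.PercolationContinuityZ3.Theorems

end
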